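import Summits.QuantumFields.QCD.Theses.HeatSlicedQuarks

/-!
# Stub `stub_freeSmoothing` of line `Sketch`
(crux `Summit.QuantumFields.QCD.Theses.HeatSlicedQuarks.InterleavedHeatSliceFlow`, item stmt-QuantumFields-8891)

**Parabolic smoothing** (reshape r3, an input of `stub_parametrixCore`: it pays for the one
"derivative" carried by the Duhamel vertex `H_U − H_1 = D_1ᴴ E + Eᴴ D_U`).  For every complex square
matrix `A`, every `τ > 0` and every vector `v`,

  `Σ_i ‖(A e^{-τ AᴴA} v) i‖² ≤ (2eτ)⁻¹ Σ_i ‖v i‖²`.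

Proof (spectral calculus).  `H = AᴴA` is Hermitian, so `H = U diag(λ) Uᴴ` with `U` the unitary
eigenvector matrix and `λ` the real eigenvalue family (`Matrix.IsHermitian.spectral_theorem`), and
`e^{-τH} = U diag(e^{-τλ}) Uᴴ` (`Matrix.exp_units_conj`, `Matrix.exp_diagonal`).  With `z = Uᴴ v` and
`y_k = e^{-τλ_k} z_k` one has `A e^{-τH} v = (A U) y`, and `(AU)ᴴ (AU) = Uᴴ H U = diag(λ)`, whence
`‖A e^{-τH} v‖² = ⟨y, diag(λ) y⟩ = Σ_k λ_k e^{-2τλ_k} |z_k|²`, while `‖v‖² = ‖U z‖² = Σ_k |z_k|²`.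
Finally `λ e^{-2τλ} ≤ (2eτ)⁻¹` for every real `λ` (from `1 + x ≤ eˣ` at `x = 2τλ - 1`).
No named facts are used (Mathlib only).
-/

namespace Summit.QuantumFields.QCD.Cruxes.InterleavedHeatSliceFlow.Sketch

open Matrix
open scoped Matrix ComplexConjugate

/-- The scalar inequality behind the smoothing estimate: `x e^{-2τx} ≤ (2eτ)⁻¹` for every real `x`
and every `τ > 0` (maximum at `x = 1/(2τ)`; it is `1 + y ≤ e^y` at `y = 2τx - 1`). -/
private theorem freeSmoothing_scalar (x τ : ℝ) (hτ : 0 < τ) :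
    x * Real.exp (-(2 * τ * x)) ≤ (2 * Real.exp 1 * τ)⁻¹ := by
  have h1 : 2 * τ * x ≤ Real.exp (2 * τ * x) * Real.exp (-1) := by
    have h := Real.add_one_le_exp (2 * τ * x - 1)
    rwa [sub_add_cancel, sub_eq_add_neg, Real.exp_add] at h
  have h2 : x * Real.exp (-(2 * τ * x)) * (2 * Real.exp 1 * τ) ≤ 1 := by
    calc x * Real.exp (-(2 * τ * x)) * (2 * Real.exp 1 * τ)
        = 2 * τ * x * (Real.exp (-(2 * τ * x)) * Real.exp 1) := by ring
      _ ≤ Real.exp (2 * τ * x) * Real.exp (-1) * (Real.exp (-(2 * τ * x)) * Real.exp 1) :=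
          mul_le_mul_of_nonneg_right h1 (by positivity)
      _ = 1 := by
          rw [← Real.exp_add, ← Real.exp_add, ← Real.exp_add, ← Real.exp_zero]
          congr 1
          ring
  rwa [← le_div_iff₀ (by positivity), one_div] at h2

/-- `Σ_i ‖x i‖² = ⟨x, x⟩ = star x ⬝ᵥ x`, as complex numbers. -/
private theorem freeSmoothing_sum_norm_sq {ι : Type*} [Fintype ι] (x : ι → ℂ) :
    (((∑ i, ‖x i‖ ^ 2 : ℝ)) : ℂ) = star x ⬝ᵥ x := by
  rw [Complex.ofReal_sum, dotProduct]
  refine Finset.sum_congr rfl fun i _ => ?_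
  rw [Pi.star_apply, Complex.star_def, Complex.conj_mul', Complex.ofReal_pow]

/-- `Σ_i ‖(M y) i‖² = ⟨y, Mᴴ M y⟩`, as complex numbers. -/
private theorem freeSmoothing_sum_norm_sq_mulVec {ι : Type*} [Fintype ι] (M : Matrix ι ι ℂ)
    (y : ι → ℂ) : (((∑ i, ‖(M *ᵥ y) i‖ ^ 2 : ℝ)) : ℂ) = star y ⬝ᵥ ((Mᴴ * M) *ᵥ y) := by
  rw [freeSmoothing_sum_norm_sq, star_mulVec, ← dotProduct_mulVec, mulVec_mulVec]

/-- **Parabolic smoothing** (registered stub `stub_freeSmoothing` of line `Sketch`, reshape r3, input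
of `stub_parametrixCore`): `Σ_i ‖(A e^{-τAᴴA} v) i‖² ≤ (2eτ)⁻¹ Σ_i ‖v i‖²` for every complex square
matrix `A`, `τ > 0` and vector `v`.  Spectral calculus: in the unitary eigenbasis of the Hermitian
matrix `AᴴA` the left side is `Σ_k λ_k e^{-2τλ_k} |z_k|²` with `z = Uᴴ v`, `Σ_k |z_k|² = Σ_i ‖v i‖²`,
and `λ e^{-2τλ} ≤ (2eτ)⁻¹`. -/
theorem stub_freeSmoothing :
    ∀ (ι : Type) [Fintype ι] [DecidableEq ι] (A : Matrix ι ι ℂ) (τ : ℝ), 0 < τ →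
      ∀ v : ι → ℂ,
        ∑ i, ‖(A * NormedSpace.exp (-(τ : ℂ) • (Aᴴ * A))).mulVec v i‖ ^ 2 ≤
          (2 * Real.exp 1 * τ)⁻¹ * ∑ i, ‖v i‖ ^ 2 := by
  intro ι _ _ A τ hτ v
  have hH : (Aᴴ * A).IsHermitian := Matrix.isHermitian_conjTranspose_mul_self A
  -- the unitary eigenvector matrix `U` and the eigenvalues `lam` of `AᴴA`
  set U : Matrix ι ι ℂ := (hH.eigenvectorUnitary : Matrix ι ι ℂ)
  set lam : ι → ℝ := hH.eigenvalues
  have hUu : Uᴴ * U = 1 := Unitary.coe_star_mul_self hH.eigenvectorUnitary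
  have hUu' : U * Uᴴ = 1 := Unitary.coe_mul_star_self hH.eigenvectorUnitary
  -- diagonalisation: `Uᴴ H U = diag(lam)` and `H = U diag(lam) Uᴴ`
  have hdiag : Uᴴ * (Aᴴ * A) * U = diagonal (fun k => ((lam k : ℝ) : ℂ)) := by
    have h := hH.conjStarAlgAut_star_eigenvectorUnitary
    rw [Unitary.conjStarAlgAut_star_apply] at h
    exact h
  have h0 : Aᴴ * A = U * diagonal (fun k => ((lam k : ℝ) : ℂ)) * Uᴴ := by
    conv_lhs => rw [hH.spectral_theorem, Unitary.conjStarAlgAut_apply]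
    rfl
  -- the heat kernel: `exp(-τH) = U diag(w) Uᴴ`, `w_k = e^{-τ lam_k}`
  set w : ι → ℂ := fun k => ((Real.exp (-(τ * lam k)) : ℝ) : ℂ) with hw
  have hspec : -(τ : ℂ) • (Aᴴ * A) =
      U * diagonal (fun k => -(τ : ℂ) * ((lam k : ℝ) : ℂ)) * Uᴴ := by
    conv_lhs => rw [h0]
    rw [← Matrix.smul_mul, ← Matrix.mul_smul, ← diagonal_smul]
    rfl
  have hwexp : NormedSpace.exp (fun k => -(τ : ℂ) * ((lam k : ℝ) : ℂ)) = w := by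
    funext k
    rw [Pi.coe_exp]
    show NormedSpace.exp (-(τ : ℂ) * ((lam k : ℝ) : ℂ)) = ((Real.exp (-(τ * lam k)) : ℝ) : ℂ)
    rw [Complex.ofReal_exp, ← Complex.exp_eq_exp_ℂ]
    push_cast
    rw [neg_mul]
  have hexp : NormedSpace.exp (-(τ : ℂ) • (Aᴴ * A)) = U * diagonal w * Uᴴ := by
    rw [hspec, ← hwexp, ← Matrix.exp_diagonal]
    exact Matrix.exp_units_conj ⟨U, Uᴴ, hUu', hUu⟩ _
  -- coordinates in the eigenbasis: `z = Uᴴ v`, `y_k = w_k z_k`, and `A e^{-τH} v = (A U) y`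
  set z : ι → ℂ := Uᴴ *ᵥ v with hz
  set y : ι → ℂ := fun k => w k * z k with hy
  have hEv : (A * NormedSpace.exp (-(τ : ℂ) • (Aᴴ * A))) *ᵥ v = (A * U) *ᵥ y := by
    rw [hexp, ← mulVec_mulVec, ← mulVec_mulVec, ← mulVec_mulVec, ← mulVec_mulVec]
    congr 2
    funext k
    rw [mulVec_diagonal]
  -- `‖(A U) y‖² = Σ_k lam_k |y_k|²`
  have hnum : (((∑ i, ‖((A * U) *ᵥ y) i‖ ^ 2 : ℝ)) : ℂ) =
      (((∑ k, lam k * ‖y k‖ ^ 2 : ℝ)) : ℂ) := by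
    rw [freeSmoothing_sum_norm_sq_mulVec, conjTranspose_mul,
      show Uᴴ * Aᴴ * (A * U) = Uᴴ * (Aᴴ * A) * U by simp only [Matrix.mul_assoc], hdiag,
      dotProduct, Complex.ofReal_sum]
    refine Finset.sum_congr rfl fun k _ => ?_
    rw [mulVec_diagonal, Pi.star_apply, Complex.star_def, mul_left_comm, Complex.conj_mul']
    push_cast
    ring
  -- `‖v‖² = ‖U z‖² = Σ_k |z_k|²`
  have hden : (((∑ i, ‖v i‖ ^ 2 : ℝ)) : ℂ) = (((∑ k, ‖z k‖ ^ 2 : ℝ)) : ℂ) := by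
    have hv : v = U *ᵥ z := by rw [hz, mulVec_mulVec, hUu', one_mulVec]
    conv_lhs => rw [hv]
    rw [freeSmoothing_sum_norm_sq_mulVec, hUu, one_mulVec, freeSmoothing_sum_norm_sq]
  -- `|y_k|² = e^{-2τ lam_k} |z_k|²`
  have hy2 : ∀ k, ‖y k‖ ^ 2 = Real.exp (-(2 * τ * lam k)) * ‖z k‖ ^ 2 := by
    intro k
    rw [hy, norm_mul, mul_pow, hw, Complex.norm_real, Real.norm_eq_abs,
      abs_of_pos (Real.exp_pos _), sq (Real.exp _), ← Real.exp_add]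
    congr 2
    ring
  -- assemble
  calc ∑ i, ‖(A * NormedSpace.exp (-(τ : ℂ) • (Aᴴ * A))).mulVec v i‖ ^ 2
      = ∑ i, ‖((A * U) *ᵥ y) i‖ ^ 2 := by rw [hEv]
    _ = ∑ k, lam k * ‖y k‖ ^ 2 := by exact_mod_cast hnum
    _ = ∑ k, lam k * Real.exp (-(2 * τ * lam k)) * ‖z k‖ ^ 2 :=
        Finset.sum_congr rfl fun k _ => by rw [hy2 k]; ring
    _ ≤ ∑ k, (2 * Real.exp 1 * τ)⁻¹ * ‖z k‖ ^ 2 :=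
        Finset.sum_le_sum fun k _ =>
          mul_le_mul_of_nonneg_right (freeSmoothing_scalar (lam k) τ hτ) (sq_nonneg _)
    _ = (2 * Real.exp 1 * τ)⁻¹ * ∑ k, ‖z k‖ ^ 2 := by rw [Finset.mul_sum]
    _ = (2 * Real.exp 1 * τ)⁻¹ * ∑ i, ‖v i‖ ^ 2 := by rw [Complex.ofReal_injective hden]

end Summit.QuantumFields.QCD.Cruxes.InterleavedHeatSliceFlow.Sketch
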